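import Summits.ValiantsHypothesis.ValiantsHypothesis.Theorems.GrenetZeonDualUnipotentThreeHalvesHeavyTopThmCnGradedCount

/-!
# `GrenetZeon.DualUnipotentThreeHalves` (stmt-ValiantsHypothesis-24318), R2 heavy-top instrument — THEOREM C(n) PORT, FRAME 2 (general size `n`):
# letters of the graded limit from the count, the lowest weight, and reducibility from a vanishing column strip

Experiment cell «val-heavytop-census» (D-0160), engine seat val-htc-eng-1 g4.  Size-general version of ✓ `…ThmCStructure` (the case `n = 7`); continuation of ✓ `…ThmCnGradedCount` (notation `P_h = W.map (dp h)`,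
`N_h = W.map (dm h)` there).  THIS FILE provides the structural lemmas used by the assemblies `…HeavyTopThmC<n>` (n = 5, 6, …):

* `jpow_mem`, `unit_mem`, `lower_band_mem` — reading members of `W` off coordinate vectors: `𝟙 ∈ P_h ⇒ J^h ∈ W`, `e_i ∈ P_h ⇒ E_{i,i+h} ∈ W`,
  `(dm h B = c) ⇒ Σ_b c_b E_{b+h,b} ∈ W` (graded: `π_{±h}` of a member is a member);
* `map_eq_top_of_finrank` — `dim P_h = n − h ⇒ P_h = ⊤` (zero slack at height `1` is ✓ `…ThmCStructure.mem_of_dot_eq_zero`, already size-free);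
* `below_of_initial` — if `N_h = ⊥` for `s < h < n` then every member of the ORIGINAL space `V` has no entry below the `s`-th subdiagonal
  (downward induction on the initial forms, ✓ `HeavyTopTorusInitial`);
* ★ `not_irreducible_of_column_strip` — if every `X ∈ V` has `X_{ab} = 0` for `b ≤ m < a` (`m + 2 ≤ n`) then `span(e_0,…,e_m)` is a non-trivial
  proper invariant subspace.

Honest framing: infrastructure for the instrument's kernel ports of Thm C(n); nothing here proves or refutes `HeavyTopLaw`/`HeavyTopSlowLaw`, 24318, S3 or
8062; `VP ≠ VNP` is NOT proved.  No definitions.  [this seat]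
-/

noncomputable section

-- single-conjunct layout: Sub = Summit, duplicated namespace component intended
set_option linter.dupNamespace false

namespace Summit.ValiantsHypothesis.ValiantsHypothesis.Theorems.GrenetZeon.HeavyTopThmCnStructure

open Matrix

/-! ## Reading members of `W` off coordinate vectors -/

/-- `𝟙 ∈ P_h ⇒ J^h ∈ W` (the explicit matrix `[b = a + h]`). -/
theorem jpow_mem {n : ℕ} (W : Submodule ℂ (Matrix (Fin n) (Fin n) ℂ))
    (hgr : ∀ A ∈ W, ∀ d : ℤ, (Matrix.of fun a b : Fin n => if (b : ℤ) - (a : ℤ) = d then A a b else 0) ∈ W) (h : ℕ)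
    (dp : Matrix (Fin n) (Fin n) ℂ →ₗ[ℂ] (Fin (n - h) → ℂ))
    (hdp : ∀ A (i : Fin (n - h)) (a b : Fin n), (a : ℕ) = i → (b : ℕ) = i + h → dp A i = A a b)
    (hone : (fun _ => (1 : ℂ)) ∈ W.map dp) :
    (Matrix.of fun a b : Fin n => if (b : ℕ) = (a : ℕ) + h then (1 : ℂ) else 0) ∈ W := by
  obtain ⟨A, hA, hAe⟩ := hone
  have key : (Matrix.of fun a b : Fin n => if (b : ℕ) = (a : ℕ) + h then (1 : ℂ) else 0) =
      Matrix.of fun a b : Fin n => if (b : ℤ) - (a : ℤ) = (h : ℤ) then A a b else 0 := by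
    ext a b
    simp only [Matrix.of_apply]
    by_cases hb : (b : ℕ) = (a : ℕ) + h
    · rw [if_pos hb, if_pos (by omega)]
      have e := congr_fun hAe ⟨(a : ℕ), by omega⟩
      rw [hdp A _ a b rfl (by simpa using hb)] at e
      exact e.symm
    · rw [if_neg hb, if_neg (by omega)]
  rw [key]; exact hgr A hA h

/-- `e_i ∈ P_h ⇒ E_{i,i+h} ∈ W`. -/
theorem unit_mem {n : ℕ} (W : Submodule ℂ (Matrix (Fin n) (Fin n) ℂ))
    (hgr : ∀ A ∈ W, ∀ d : ℤ, (Matrix.of fun a b : Fin n => if (b : ℤ) - (a : ℤ) = d then A a b else 0) ∈ W) (h : ℕ)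
    (dp : Matrix (Fin n) (Fin n) ℂ →ₗ[ℂ] (Fin (n - h) → ℂ))
    (hdp : ∀ A (i : Fin (n - h)) (a b : Fin n), (a : ℕ) = i → (b : ℕ) = i + h → dp A i = A a b)
    (i : Fin (n - h)) (hi : Pi.single i (1 : ℂ) ∈ W.map dp) :
    (Matrix.of fun a b : Fin n => if (a : ℕ) = (i : ℕ) ∧ (b : ℕ) = (i : ℕ) + h then (1 : ℂ) else 0) ∈ W := by
  classical
  obtain ⟨A, hA, hAe⟩ := hi
  have key : (Matrix.of fun a b : Fin n => if (a : ℕ) = (i : ℕ) ∧ (b : ℕ) = (i : ℕ) + h then (1 : ℂ) else 0) =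
      Matrix.of fun a b : Fin n => if (b : ℤ) - (a : ℤ) = (h : ℤ) then A a b else 0 := by
    ext a b
    simp only [Matrix.of_apply]
    by_cases hb : (b : ℤ) - (a : ℤ) = (h : ℤ)
    · rw [if_pos hb]
      have e := congr_fun hAe ⟨(a : ℕ), by omega⟩
      rw [hdp A _ a b rfl (show (b : ℕ) = (a : ℕ) + h by omega), Pi.single_apply] at e
      rw [e]
      by_cases hai : (a : ℕ) = (i : ℕ)
      · rw [if_pos ⟨hai, by omega⟩, if_pos (Fin.ext hai)]
      · rw [if_neg (fun hh => hai hh.1), if_neg (fun hh => hai (by rw [Fin.ext_iff] at hh; exact hh))]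
    · rw [if_neg hb, if_neg (fun hh => hb (by omega))]
  rw [key]; exact hgr A hA h

/-- `dm h B` read as a lower band: if `B ∈ W` and `c_i = (dm h B)_i` for `i < n − h`, then `Σ_b c_b E_{b+h,b} ∈ W`. -/
theorem lower_band_mem {n : ℕ} (W : Submodule ℂ (Matrix (Fin n) (Fin n) ℂ))
    (hgr : ∀ A ∈ W, ∀ d : ℤ, (Matrix.of fun a b : Fin n => if (b : ℤ) - (a : ℤ) = d then A a b else 0) ∈ W) (h : ℕ)
    (dm : Matrix (Fin n) (Fin n) ℂ →ₗ[ℂ] (Fin (n - h) → ℂ))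
    (hdm : ∀ A (i : Fin (n - h)) (a b : Fin n), (a : ℕ) = i + h → (b : ℕ) = i → dm A i = A a b)
    (B : Matrix (Fin n) (Fin n) ℂ) (hB : B ∈ W) (c : Fin n → ℂ)
    (hc : ∀ i : Fin (n - h), c ⟨(i : ℕ), by omega⟩ = dm B i) :
    (Matrix.of fun a b : Fin n => if (a : ℕ) = (b : ℕ) + h then c b else 0) ∈ W := by
  have key : (Matrix.of fun a b : Fin n => if (a : ℕ) = (b : ℕ) + h then c b else 0) =
      Matrix.of fun a b : Fin n => if (b : ℤ) - (a : ℤ) = -(h : ℤ) then B a b else 0 := by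
    ext a b
    simp only [Matrix.of_apply]
    by_cases hab : (a : ℕ) = (b : ℕ) + h
    · rw [if_pos hab, if_pos (by omega)]
      have e := hc ⟨(b : ℕ), by omega⟩
      rw [hdm B _ a b (by simpa using hab) rfl] at e
      simpa using e
    · rw [if_neg hab, if_neg (by omega)]
  rw [key]; exact hgr B hB (-(h : ℤ))

/-! ## Zero slack -/

/-- `dim P_h = n − h ⇒ P_h = ⊤`. -/
theorem map_eq_top_of_finrank {n : ℕ} (h : ℕ) (P : Submodule ℂ (Fin (n - h) → ℂ)) (hP : Module.finrank ℂ P = n - h) : P = ⊤ :=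
  Submodule.eq_top_of_finrank_eq (by rw [hP, Module.finrank_fin_fun])

/-! ## The lowest weight controls the original space -/

/-- **Entries below the lowest weight vanish on `V`.**  If the initial forms of members of `V` lie in `W` and `N_h = ⊥` for `s < h < n`, then
every `Z ∈ V` has `Z_{ab} = 0` whenever `a > b + s`. -/
theorem below_of_initial {n : ℕ} (V W : Submodule ℂ (Matrix (Fin n) (Fin n) ℂ))
    (hinit : ∀ Z ∈ V, ∀ d : ℤ, (∀ a b : Fin n, (b : ℤ) - (a : ℤ) < d → Z a b = 0) →
      (Matrix.of fun a b : Fin n => if (b : ℤ) - (a : ℤ) = d then Z a b else 0) ∈ W)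
    (dm : ∀ h : ℕ, Matrix (Fin n) (Fin n) ℂ →ₗ[ℂ] (Fin (n - h) → ℂ))
    (hdm : ∀ h A (i : Fin (n - h)) (a b : Fin n), (a : ℕ) = i + h → (b : ℕ) = i → dm h A i = A a b)
    (s : ℕ) (hN : ∀ h : ℕ, s < h → h < n → W.map (dm h) = ⊥) :
    ∀ Z ∈ V, ∀ a b : Fin n, (b : ℕ) + s < (a : ℕ) → Z a b = 0 := by
  -- `claim k`: entries with `a − b ≥ n − k` vanish, for `k + s < n`
  have claim : ∀ k : ℕ, k + s < n → ∀ Z ∈ V, ∀ a b : Fin n, (b : ℕ) + (n - k) ≤ (a : ℕ) → Z a b = 0 := by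
    intro k
    induction k with
    | zero => intro _ Z _ a b hab; have := a.isLt; omega
    | succ k ih =>
      intro hk Z hZ a b hab
      by_cases hlt : (b : ℕ) + (n - k) ≤ (a : ℕ)
      · exact ih (by omega) Z hZ a b hlt
      · -- the new diagonal `a - b = n - 1 - k =: h`, with `s < h < n`
        have hab' : (a : ℕ) = (b : ℕ) + (n - 1 - k) := by omega
        have hmem := hinit Z hZ (-((n - 1 - k : ℕ) : ℤ)) (fun a' b' hlt' => ih (by omega) Z hZ a' b' (by omega))
        have hq : dm (n - 1 - k) (Matrix.of fun a b : Fin n => if (b : ℤ) - (a : ℤ) = -((n - 1 - k : ℕ) : ℤ) then Z a b else 0) = 0 := by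
          have hb := hN (n - 1 - k) (by omega) (by omega)
          rw [Submodule.eq_bot_iff] at hb
          exact hb _ ⟨_, hmem, rfl⟩
        have e := congr_fun hq ⟨(b : ℕ), by omega⟩
        rw [hdm (n - 1 - k) _ _ a b (show (a : ℕ) = (b : ℕ) + (n - 1 - k) by omega) rfl, Matrix.of_apply, if_pos (by omega),
          Pi.zero_apply] at e
        exact e
  intro Z hZ a b hab
  have := a.isLt
  exact claim (n - 1 - s) (by omega) Z hZ a b (by omega)

/-! ## Reducibility from a vanishing column strip -/

/-- ★ **A vanishing column strip gives an invariant flag piece.**  If every `X ∈ V` has `X_{ab} = 0` for `b ≤ m < a` (`m + 2 ≤ n`), then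
`span(e_0, …, e_m)` is a non-zero proper subspace invariant under `V`; so `V` is not irreducible. -/
theorem not_irreducible_of_column_strip {n : ℕ} (V : Submodule ℂ (Matrix (Fin n) (Fin n) ℂ)) (m : ℕ) (hm : m + 2 ≤ n)
    (hcol : ∀ X ∈ V, ∀ a b : Fin n, (b : ℕ) ≤ m → m < (a : ℕ) → X a b = 0) :
    ¬ ∀ U : Submodule ℂ (Fin n → ℂ), (∀ A ∈ V, ∀ x ∈ U, A *ᵥ x ∈ U) → U = ⊥ ∨ U = ⊤ := by
  classical
  intro hirr
  set U : Submodule ℂ (Fin n → ℂ) := Submodule.span ℂ (Set.range fun k : Fin (m + 1) => Pi.single (⟨(k : ℕ), by omega⟩ : Fin n) (1 : ℂ))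
    with hU
  -- members of `U` vanish beyond `m`
  have hUvan : ∀ x ∈ U, ∀ a : Fin n, m < (a : ℕ) → x a = 0 := by
    intro x hx a ha
    induction hx using Submodule.span_induction with
    | mem y hy =>
      obtain ⟨k, rfl⟩ := hy
      dsimp only
      rw [Pi.single_apply, if_neg]
      intro hak; rw [Fin.ext_iff] at hak; simp at hak; omega
    | zero => rfl
    | add y z _ _ hy hz => rw [Pi.add_apply, hy, hz, add_zero]
    | smul t y _ hy => rw [Pi.smul_apply, hy, smul_zero]
  -- vectors vanishing beyond `m` lie in `U`
  have hUmem : ∀ x : Fin n → ℂ, (∀ a : Fin n, m < (a : ℕ) → x a = 0) → x ∈ U := by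
    intro x hx
    have hxe : x = ∑ k : Fin (m + 1), x ⟨(k : ℕ), by omega⟩ • Pi.single (⟨(k : ℕ), by omega⟩ : Fin n) (1 : ℂ) := by
      funext a
      rw [Finset.sum_apply]
      simp only [Pi.smul_apply, Pi.single_apply, smul_eq_mul, mul_ite, mul_one, mul_zero]
      by_cases ha : m < (a : ℕ)
      · rw [hx a ha]; symm
        refine Finset.sum_eq_zero fun k _ => ?_
        rw [if_neg]; intro hak; rw [Fin.ext_iff] at hak; simp at hak; omega
      · rw [Finset.sum_eq_single ⟨(a : ℕ), by omega⟩]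
        · rw [if_pos (Fin.ext rfl)]
        · intro k _ hk; rw [if_neg]; intro hak; apply hk; rw [Fin.ext_iff] at hak ⊢; simp at hak ⊢; omega
        · intro hh; exact absurd (Finset.mem_univ _) hh
    rw [hxe]
    exact U.sum_mem fun k _ => U.smul_mem _ (Submodule.subset_span ⟨k, rfl⟩)
  have hUinv : ∀ A ∈ V, ∀ x ∈ U, A *ᵥ x ∈ U := by
    intro A hA x hx
    apply hUmem
    intro a ha
    rw [Matrix.mulVec, dotProduct]
    refine Finset.sum_eq_zero fun b _ => ?_
    by_cases hb : (b : ℕ) ≤ m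
    · rw [hcol A hA a b hb ha, zero_mul]
    · rw [hUvan x hx b (by omega), mul_zero]
  rcases hirr U hUinv with h0 | h1
  · have hmem : Pi.single (⟨0, by omega⟩ : Fin n) (1 : ℂ) ∈ U := Submodule.subset_span ⟨⟨0, by omega⟩, rfl⟩
    rw [h0, Submodule.mem_bot] at hmem
    have := congr_fun hmem ⟨0, by omega⟩
    simp at this
  · have hmem : Pi.single (⟨n - 1, by omega⟩ : Fin n) (1 : ℂ) ∈ U := by rw [h1]; exact Submodule.mem_top
    have := hUvan _ hmem ⟨n - 1, by omega⟩ (by simp; omega)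
    simp at this

end Summit.ValiantsHypothesis.ValiantsHypothesis.Theorems.GrenetZeon.HeavyTopThmCnStructure

end
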